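import Literature.NumberTheory.EllipticCurves.KrizLi2019.TwoPartBSDTwists
import Literature.NumberTheory.EllipticCurves.ArtinMilneShaDecomposition
import Literature.NumberTheory.EllipticCurves.QuadraticTwistJInvariantProofs
import Literature.NumberTheory.EllipticCurves.QuadraticTwistPadicReduction
import HarnessLib

/-!
# Kriz–Li 2019, Thm. 5.1 (2) (= arXiv:1606.03172 Thm. 1.12 (2)): the printed proof, one level down —
# `thm112_bsdTwo_twist` REDUCED to Thm. 4.3, Thm. 5.1 (1), Lemma 5.12 and Milne's isogeny invariance

Sibling PROOF file of `Literature.NumberTheory.EllipticCurves.KrizLi2019.TwoPartBSDTwists` (the named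
fact `thm112_bsdTwo_twist`: D. Kriz, C. Li, *Goldfeld's conjecture and congruences between Heegner
points*, Forum Math. Sigma 7 (2019) e15, Thm. 5.1 (2) = arXiv:1606.03172 Thm. 1.12 (2); texts read:
`paper:arxiv-1606.03172` p0016–p0018 (arXiv §§4–5, LaTeX text) and `paper:doi-10-1017-fms-2019-9`
chunks p0014–p0016 (FMS §5, numbering Thm. 5.1, Lemma 5.4, Cor. 5.5, Lemma 5.6, Lemma 5.7, Cor. 5.8,
Lemma 5.9, Lemma 5.10, Cor. 5.11, Lemma 5.12, §5.6)). Unit `bsd-input-krizli-thm112` (LADDER-BSD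
inputs→unconditional; consumer `Summits/BirchSwinnertonDyer/…/PublishedFactsCf2`, item 20369).

HONEST FRAMING. Nothing here proves `thm112_bsdTwo_twist` outright and nothing here bears on the
summit statement `BirchSwinnertonDyer`: the file PROVES the parts of the printed proof the tree can
carry today and states the theorem as an implication from its remaining printed inputs, typed. An
AI-typed statement is established only by the kernel check of this file; typed ≠ proved.

## The printed proof (FMS §5.1 "strategy" and §5.6 = arXiv §4.1 and §5.3, p0016 L5–L7, p0018 L59)

Standing data: `E/ℚ` with `E(ℚ)[2] = 0`, `K` imaginary quadratic with the Heegner hypothesis and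
Assumption (★), `c₂(E)` odd, Manin constant odd if additive at `2`; `d ∈ 𝒩`, `χ_d(−N) = 1`.
* (R) Thm. 4.3 (= arXiv 3.3): rank parts of BSD for `E^{(d)}`, `E^{(d·d_K)}`; exactly one of them has
  (algebraic = analytic) rank `0`, the other rank `1`. — tree named fact `thm33_rank_twist`.
* (A) "Because the abelian surface `E × E^{(d_K)}/ℚ` is isogenous to the Weil restriction `Res_{K/ℚ} E`
  and the validity of the BSD conjecture for abelian varieties is invariant under isogeny ([50] =
  Milne, *Arithmetic duality theorems*), BSD(2) for `E/ℚ` and `E^{(d_K)}/ℚ` implies BSD(2) for `E/K`."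
* (B) Thm. 5.1 (1) (= arXiv 1.12 (1)): "If BSD(2) is true for `E/K`, then BSD(2) is true for
  `E^{(d)}/K`, for any `d ∈ 𝒩`" (FMS §§5.2–5.4: the Gross–Zagier index identities (17), (18);
  Lemma 5.4 / 5.7: their right-hand sides are `2`-adic units, by (★), resp. by the `2`-adic logarithm
  congruence Thm. 4.3 (1) and the oddness of the Manin constant of `E^{(d)}` (Stevens' twisting
  argument); Cor. 5.5 / 5.8: BSD(2) over `K` ⟺ all Tamagawa numbers odd and `Ш[2] = 0`; Lemma 5.6:
  `c_ℓ(E^{(d)})` odd; Lemma 5.9: `Sel₂(E/K) ≅ Sel₂(E^{(d)}/K)` (Mazur–Rubin silent primes, local Tate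
  duality, Lang's theorem)).
* (C) Lemma 5.12 (= arXiv 5.3): "If BSD(2) is true for `E/ℚ` and `E^{(d_K)}/ℚ`, then BSD(2) is true for
  all twists `E^{(d)}/ℚ` and `E^{(d·d_K)}/ℚ` of rank zero, where `d ∈ 𝒩` with `χ_d(−N) = 1`" (FMS §5.5:
  Lemma 5.10 `Sel₂(E/ℚ)` vs `Sel₂(E^{(d)}/ℚ)`, Cor. 5.11, and Zhai 2016 [89] for
  `ord₂(L(E^{(d)},1)/Ω(E^{(d)})) = 0`).
* (D) "Then again by the invariance of BSD(2) under isogeny, we know BSD(2) is also true for the other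
  rank one curve among `E^{(d)}/ℚ` and `E^{(d·d_K)}/ℚ`" (BSD(2) for `E^{(d)}/K` = BSD(2) for
  `Res_{K/ℚ} E^{(d)}_K ∼ E^{(d)} × E^{(d·d_K)}`).

## What this file PROVES and what it takes as input

* §1 `quadraticLayer`: Artin formalism for `K/ℚ` — `L(E_K,s)` entire, `r_an(E/K) = r_an(E) +
  r_an(E^{(d_K)})`, `Λ(E/K) = Λ(E)Λ(E^{(d_K)})`, `rank E(K) = rank E(ℚ) + rank E^{(d_K)}(ℚ)` — from the
  tree's THEOREMS (`LSeries_baseChange_relQuadratic`, …, base `ℚ`), transported to a model `W₀ ≅ W^{(d_K)}`.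
* §2 the `K/ℚ` layer of Milne 1972 Thm. 1 + isogeny invariance of `BSD_p` (Dokchitser–Dokchitser 2010
  Thm. 2.3, `p`-part): `bsdQuotientP_baseChange_quadratic`, the product formula
  `analyticSha_baseChange_quadratic` and the valuation bookkeeping
  `padicValRat_analyticSha_baseChange_quadratic` (`δ_p(E/K) = δ_p(E) + δ_p(E^{(d_K)})`,
  `δ_p = ord_p #Ш_an − ord_p #Ш[p^∞]`) — PROVED from the tree's NAMED FACT
  `Milne1972.bsdQuotientP_baseChange_relQuadratic_anyModel` (`ArtinMilneShaDecomposition.lean`; this is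
  Kriz–Li's reference [50]) in the currency `analyticSha` / `BSDpOver` of
  `BSDQuotientOverNumberField.lean` ("BSD(2) for `E/K`": the tree had no such currency when the target
  was vendored — module docstring of `TwoPartBSDTwists.lean`, "Part (1) … is NOT transcribed").
* §3 steps (A) `bsdpOver_baseChange_of_bsdp` and (D) `bsdp_of_bsdpOver_baseChange`, PROVED (from `hM`).
* §4 the twist pair: `E^{(d·d_K)} ≅ (E^{(d)})^{(d_K)}`, `E^{(d)} ≅ (E^{(d·d_K)})^{(d_K)}` over `ℚ` and
  `E^{(d)}_K ≅ E^{(d·d_K)}_K` over `K` on the chosen globally minimal models, PROVED.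
* §5 `thm112_bsdTwo_twist_of_overK_of_rankZero`: **`thm112_bsdTwo_twist` follows from** (R) the tree
  fact `thm33_rank_twist`, Gross–Zagier–Kolyvagin `rank_eq_analyticRank_of_analyticRank_le_one`
  (finiteness of `Ш` of the rank-one twist, used tacitly in print), modularity `hasEntireLFunction_rat`,
  Milne's `bsdQuotientP_baseChange_relQuadratic_anyModel`, and the two Kriz–Li inputs (B) Thm. 5.1 (1)
  and (C) Lemma 5.12 TYPED INLINE as hypotheses (`h51`, `h512`; D-0026: no new named fact is minted —
  their `def … : Prop` transcriptions are filed as evidence on item 20369 for the planner to vendor or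
  seat). "BSD(2) for a curve over `K`" is read as Miller's `BSD(·, 2)` (LMS J. Comput. Math. 14 (2011)
  Def. 1.1, the notion of Remark 5.2's reference [51]) over `K`: the rank part and `BSDpOver (·_K) 2`.

NOT done here (each a printed theorem the tree cannot prove today; see the evidence note's repair
census): (B) itself — needs the Gross–Zagier index formula for `E/K` and `E^{(d)}/K` with Manin
constants (FMS (17), (18); Gross 1991), `2`-Selmer groups over `K` with local conditions, Néron
component groups; (C) itself — the tree HAS Zhai 2016 Thms. 1.1/1.2 (`Zhai2016.thm11_…`, `thm12_…`,
for `Γ₀(C)`-OPTIMAL `E`), but Lemma 5.12 for a general `E` also needs the odd-isogeny invariance of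
`ord₂ L^{alg}`, Lemma 5.10 / Cor. 5.11 (`Sel₂` over `ℚ`, Monsky's parity, global duality) and Lemma 5.6.

## References
* D. Kriz, C. Li, Forum Math. Sigma 7 (2019) e15, doi:10.1017/fms.2019.9, §5 (Thm. 5.1, Lemma 5.4 –
  Lemma 5.12, §5.6) = arXiv:1606.03172 §§4–5 (Thm. 1.12, Lemma 4.1 – Lemma 5.3, §5.3). [KrizLi2019]
* J. S. Milne, *On the arithmetic of abelian varieties*, Invent. Math. 17 (1972), §1 Thm. 1, §2
  Example 1; *Arithmetic Duality Theorems*, 2nd ed. (2006), Thm. I.7.3, Remark I.7.4 (Kriz–Li's [50]).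
  [Milne1972ArithmeticAV] [MilneADT2006]
* T. Dokchitser, V. Dokchitser, Ann. of Math. 172 (2010), §2.1 Thm. 2.3 (`p`-part) and its proof.
  [DokchitserDokchitserAnnals2010]
* R. L. Miller, LMS J. Comput. Math. 14 (2011), Def. 1.1 (`BSD(E,p)`; Kriz–Li's [51]). [Miller2011LMS]
* K. Ireland, M. Rosen, GTM 84, 2nd ed., Prop. 20.5.4. [IrelandRosen1990]
* J. H. Silverman, *AEC*, 2nd ed., X.2 Prop. 2.4, X.5 Cor. 5.4, Exercise 10.16. [SilvermanAEC2009]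
* S. Zhai, Asian J. Math. 20 (2016), Thms. 1.1–1.2 (Kriz–Li's [89]). [Zhai2016]

## Design notes
`namespace Literature.NumberTheory.EllipticCurves.KrizLi2019`, `K : Type` (universe `0`) as in the
target and in Milne's fact; the `ℚ`-side in Miller's currency (`BSDp`, `shaAn` on globally minimal
models), the `K`-side on the canonical model `W.baseChange K` (Milne's fact is stated for ANY model).
No `instance`, no notation, no new `def … : Prop`.
-/

noncomputable section

open scoped Classical

open NumberField WeierstrassCurve Literature.NumberTheory.EllipticCurves
  Literature.NumberTheory.EllipticCurves.ModularForms

namespace Literature.NumberTheory.EllipticCurves.KrizLi2019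

/-! ### §1. The quadratic layer `K/ℚ`: Artin formalism for `L`, ranks and leading coefficients -/

/-- For `K` quadratic of discriminant `d_K` and `W₀ ≅ W^{(d_K)}` over `ℚ`: `L(E_K,s)` has an entire
continuation, `r_an(E/K) = r_an(E) + r_an(E^{(d_K)})`, `Λ(E/K) = Λ(E) Λ(E^{(d_K)})` and
`rank E(K) = rank E(ℚ) + rank E^{(d_K)}(ℚ)` — the tree's relative-quadratic theorems
(`ArtinMilneShaDecomposition.lean`, base `ℚ`, `M = K = ℚ(√c)`, `d_K = c q²`) transported to the
model `W₀`. [cite: IrelandRosen1990, Ch. 20 §5, Prop. 20.5.4 (a), (b)] -/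
theorem quadraticLayer (W : WeierstrassCurve ℚ) [W.IsElliptic] (K : Type) [Field K] [NumberField K]
    (h2 : Module.finrank ℚ K = 2) (W₀ : WeierstrassCurve ℚ) [W₀.IsElliptic]
    (hW₀ : ∃ C : VariableChange ℚ, C • W₀ = W.quadraticTwist (NumberField.discr K : ℚ))
    (hL : W.HasEntireLFunction) (hL₀ : W₀.HasEntireLFunction) :
    (W.baseChange K).HasEntireLFunction ∧
      (W.baseChange K).analyticRank = W.analyticRank + W₀.analyticRank ∧
      (W.baseChange K).leadingLCoeff = W.leadingLCoeff * W₀.leadingLCoeff ∧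
      (W.baseChange K).mordellWeilRank = W.mordellWeilRank + W₀.mordellWeilRank := by
  obtain ⟨θ, c, hθK, hθ⟩ :=
    Literature.NumberTheory.QuadraticFields.Quadratic.exists_sq_eq_algebraMap (F := ℚ) (K := K) h2
  obtain ⟨q, hq, hd⟩ := NumberField.exists_discr_eq_mul_sq h2 hθK hθ
  obtain ⟨C₁, hC₁⟩ := W.exists_variableChange_quadraticTwist_mul_sq c q hq
  obtain ⟨C₀, hC₀⟩ := hW₀
  -- `W₀ = (C₀⁻¹ C₁) • W^{(c)}`
  have hW₀c : (C₀⁻¹ * C₁) • W.quadraticTwist c = W₀ := by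
    rw [mul_smul, hC₁, ← hd, ← hC₀, inv_smul_smul]
  have hc0 : c ≠ 0 := by
    rintro rfl
    rw [map_zero, pow_eq_zero_iff two_ne_zero] at hθ
    exact hθK ⟨0, by rw [map_zero, hθ]⟩
  haveI := W.isElliptic_quadraticTwist hc0
  have hLc : (W.quadraticTwist c).HasEntireLFunction := by
    rw [← hasEntireLFunction_smul_iff _ (C₀⁻¹ * C₁), hW₀c]; exact hL₀
  obtain ⟨hK, -⟩ := W.hasEntireLFunction_baseChange_relQuadratic K h2 hθ hθK hL hLc
  refine ⟨hK, ?_, ?_, ?_⟩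
  · rw [W.analyticRank_baseChange_relQuadratic K h2 hθ hθK hL hLc, ← hW₀c, analyticRank_smul]
  · rw [W.leadingLCoeff_baseChange_relQuadratic K h2 hθ hθK hL hLc, ← hW₀c, leadingLCoeff_smul]
  · rw [W.mordellWeilRank_baseChange_relQuadratic K h2 hθ hθK, ← hW₀c]
    exact congrArg _ (mordellWeilRank_variableChange_holds _ _).symm

/-! ### §2. Milne 1972 / Dokchitser–Dokchitser 2010 for the layer `K/ℚ` at a prime `p`:
`BSD_p(E_K) = r · BSD_p(E) · BSD_p(E^{(d_K)})`, `ord_p r = 0`, and the resulting bookkeeping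
`δ_p(E/K) = δ_p(E) + δ_p(E^{(d_K)})` for `δ_p = ord_p #Ш_an − ord_p #Ш[p^∞]` -/

/-- For a globally minimal `W/ℚ` the any-model currency is the `ℚ`-currency (`bsdPeriod = realPeriodRat`,
`modifiedTamagawaProduct = tamagawaProduct`). [folklore] -/
private theorem bsdQuotientP_rat_eq (W : WeierstrassCurve ℚ) [W.IsElliptic] [W.IsGloballyMinimal]
    (n : ℕ) :
    (n : ℝ) * W.regulator * W.bsdPeriod * (W.modifiedTamagawaProduct : ℝ) /
        (W.torsionOrder : ℝ) ^ 2 =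
      (n : ℝ) * W.regulator * W.realPeriodRat * (W.tamagawaProduct : ℝ) /
        (W.torsionOrder : ℝ) ^ 2 := by
  rw [W.bsdPeriod_eq_realPeriod_baseChange, ← W.realPeriodRat_def,
    W.modifiedTamagawaProduct_eq_tamagawaProduct_of_isGloballyMinimal, Rat.cast_natCast]

/-- **The `p`-part of the Birch–Swinnerton-Dyer quotient under the base change `K/ℚ`** (Milne 1972
Thm. 1 for `Res_{K/ℚ} E_K ∼ E × E^{(d_K)}` with the isogeny invariance of `BSD_p`, in the form of
Dokchitser–Dokchitser 2010 Thm. 2.3, `p`-part — the tree's named fact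
`Milne1972.bsdQuotientP_baseChange_relQuadratic_anyModel` APPLIED to the layer `ℚ ⊂ K = ℚ(√c)`,
`d_K = c q²`): for `W/ℚ` and a model `W₀ ≅ W^{(d_K)}`, both globally minimal, and any `K`-model `V`
of `E_K`, if `Ш(E)[p^∞]`, `Ш(E^{(d_K)})[p^∞]` are finite then `Ш(E_K)[p^∞]` is finite and
`BSD_p(E_K/K) = r · BSD_p(E/ℚ) · BSD_p(E^{(d_K)}/ℚ)` with `r ∈ ℚ^×`, `ord_p r = 0` (the `ℚ`-side in the
`ℚ`-currency `realPeriodRat`, `tamagawaProduct`). This is the step "[50] (Milne)" of Kriz–Li's proof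
of Thm. 5.1 (2) (FMS §5.6 = arXiv:1606.03172 §5.3, p0018 L59: "the abelian surface `E × E^{(d_K)}/ℚ`
is isogenous to the Weil restriction `Res_{K/ℚ} E` and the validity of BSD … is invariant under
isogeny").
[cite: DokchitserDokchitserAnnals2010, §2.1 Thm. 2.3 (second clause) and its proof]
[cite: Milne1972ArithmeticAV, §1 Thm. 1; §2 Example 1 (p. 185)]
[cite: KrizLi2019, §5.6 (FMS) = arXiv:1606.03172 §5.3 (p0018 L59)] -/
theorem bsdQuotientP_baseChange_quadratic
    (hM : Milne1972.bsdQuotientP_baseChange_relQuadratic_anyModel)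
    (W : WeierstrassCurve ℚ) [W.IsElliptic] [W.IsGloballyMinimal]
    (K : Type) [Field K] [NumberField K] (h2 : Module.finrank ℚ K = 2)
    (W₀ : WeierstrassCurve ℚ) [W₀.IsElliptic] [W₀.IsGloballyMinimal]
    (hW₀ : ∃ C : VariableChange ℚ, C • W₀ = W.quadraticTwist (NumberField.discr K : ℚ))
    (V : WeierstrassCurve K) [V.IsElliptic] (hV : ∃ C : VariableChange K, C • W.baseChange K = V)
    (p : ℕ) [Fact p.Prime]
    (hfW : Finite (AddCommGroup.primaryComponent W.sha p))
    (hfW₀ : Finite (AddCommGroup.primaryComponent W₀.sha p)) :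
    Finite (AddCommGroup.primaryComponent V.sha p) ∧
    ∃ r : ℚ, r ≠ 0 ∧ padicValRat p r = 0 ∧
      (Nat.card (AddCommGroup.primaryComponent V.sha p) : ℝ) * V.regulator * V.bsdPeriod *
          (V.modifiedTamagawaProduct : ℝ) / (V.torsionOrder : ℝ) ^ 2 =
        (r : ℝ) *
          ((Nat.card (AddCommGroup.primaryComponent W.sha p) : ℝ) * W.regulator *
              W.realPeriodRat * (W.tamagawaProduct : ℝ) / (W.torsionOrder : ℝ) ^ 2 *
            ((Nat.card (AddCommGroup.primaryComponent W₀.sha p) : ℝ) * W₀.regulator *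
              W₀.realPeriodRat * (W₀.tamagawaProduct : ℝ) / (W₀.torsionOrder : ℝ) ^ 2)) := by
  obtain ⟨θ, c, hθK, hθ⟩ :=
    Literature.NumberTheory.QuadraticFields.Quadratic.exists_sq_eq_algebraMap (F := ℚ) (K := K) h2
  obtain ⟨q, hq, hd⟩ := NumberField.exists_discr_eq_mul_sq h2 hθK hθ
  obtain ⟨C₁, hC₁⟩ := W.exists_variableChange_quadraticTwist_mul_sq c q hq
  obtain ⟨C₀, hC₀⟩ := hW₀
  have hW₀c : ∃ C : VariableChange ℚ, C • W.quadraticTwist c = W₀ :=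
    ⟨C₀⁻¹ * C₁, by rw [mul_smul, hC₁, ← hd, ← hC₀, inv_smul_smul]⟩
  obtain ⟨hKfin, r, hr0, hrp, hQ⟩ := hM ℚ K h2 c θ hθ hθK W W₀ hW₀c V hV p hfW hfW₀
  refine ⟨hKfin, r, hr0, hrp, ?_⟩
  rw [hQ, bsdQuotientP_rat_eq W, bsdQuotientP_rat_eq W₀]

/-- `#Ш_an(X) · B(X) = Λ(X)` with `B(X) = Reg·Ω·C/#tors²` on any model of an elliptic curve over a
number field (unfolding `analyticSha`; the factors are non-zero). [folklore] -/
private theorem analyticSha_mul_B {F : Type*} [Field F] [NumberField F] (V : WeierstrassCurve F)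
    [V.IsElliptic] :
    analyticSha V * ((V.regulator * V.bsdPeriod * (V.modifiedTamagawaProduct : ℝ) /
        (V.torsionOrder : ℝ) ^ 2 : ℝ) : ℂ) = V.leadingLCoeff := by
  have hΩ : (V.bsdPeriod : ℂ) ≠ 0 := by exact_mod_cast V.bsdPeriod_pos'.ne'
  have hc : (V.modifiedTamagawaProduct : ℂ) ≠ 0 := by
    exact_mod_cast (V.modifiedTamagawaProduct_pos).ne'
  have hR : (V.regulator : ℂ) ≠ 0 := by exact_mod_cast V.regulator_pos'.ne'
  have ht : (V.torsionOrder : ℂ) ≠ 0 := by exact_mod_cast V.torsionOrder_pos_holds.ne'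
  rw [analyticSha_def]
  push_cast
  field_simp

/-- `B(X) = Reg·Ω·C/#tors² ≠ 0` (all factors positive). [folklore] -/
private theorem B_ne_zero {F : Type*} [Field F] [NumberField F] (V : WeierstrassCurve F)
    [V.IsElliptic] :
    ((V.regulator * V.bsdPeriod * (V.modifiedTamagawaProduct : ℝ) /
        (V.torsionOrder : ℝ) ^ 2 : ℝ) : ℂ) ≠ 0 := by
  have hΩ : (0 : ℝ) < V.bsdPeriod := V.bsdPeriod_pos'
  have hc : (0 : ℝ) < V.modifiedTamagawaProduct := by exact_mod_cast V.modifiedTamagawaProduct_pos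
  have hR : (0 : ℝ) < V.regulator := V.regulator_pos'
  have ht : (0 : ℝ) < V.torsionOrder := Nat.cast_pos.mpr V.torsionOrder_pos_holds
  exact_mod_cast (by positivity : (0 : ℝ) < V.regulator * V.bsdPeriod *
    (V.modifiedTamagawaProduct : ℝ) / (V.torsionOrder : ℝ) ^ 2).ne'

/-- **`#Ш_an` over `K/ℚ`.** For `W`, `W₀ ≅ W^{(d_K)}` globally minimal over `ℚ` with entire
`L`-functions, `V` any `K`-model of `E_K`, and a prime `p` with `Ш(E)[p^∞]`, `Ш(E^{(d_K)})[p^∞]`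
finite: `Ш(E_K)[p^∞]` is finite and
`#Ш_an(E_K) · r · #Ш(E)[p^∞] · #Ш(E^{(d_K)})[p^∞] = #Ш(E_K)[p^∞] · #Ш_an(E) · #Ш_an(E^{(d_K)})` for some
`r ∈ ℚ^×` with `ord_p r = 0` (`analyticSha` of `BSDQuotientOverNumberField.lean`; over `ℚ` Miller's
`shaAn`): the leading coefficients multiply (Artin formalism, `quadraticLayer`) and the
`BSD_p`-quotients multiply up to `r` (`bsdQuotientP_baseChange_quadratic`).
[cite: DokchitserDokchitserAnnals2010, §2.1 Thm. 2.3 (second clause) and its proof]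
[cite: Miller2011LMS, §1 and Def. 1.1 (arXiv:1010.2431 p. 3)] -/
theorem analyticSha_baseChange_quadratic
    (hM : Milne1972.bsdQuotientP_baseChange_relQuadratic_anyModel)
    (W : WeierstrassCurve ℚ) [W.IsElliptic] [W.IsGloballyMinimal]
    (K : Type) [Field K] [NumberField K] (h2 : Module.finrank ℚ K = 2)
    (W₀ : WeierstrassCurve ℚ) [W₀.IsElliptic] [W₀.IsGloballyMinimal]
    (hW₀ : ∃ C : VariableChange ℚ, C • W₀ = W.quadraticTwist (NumberField.discr K : ℚ))
    (V : WeierstrassCurve K) [V.IsElliptic] (hV : ∃ C : VariableChange K, C • W.baseChange K = V)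
    (p : ℕ) [Fact p.Prime]
    (hfW : Finite (AddCommGroup.primaryComponent W.sha p))
    (hfW₀ : Finite (AddCommGroup.primaryComponent W₀.sha p))
    (hL : W.HasEntireLFunction) (hL₀ : W₀.HasEntireLFunction) :
    Finite (AddCommGroup.primaryComponent V.sha p) ∧
    ∃ r : ℚ, r ≠ 0 ∧ padicValRat p r = 0 ∧
      analyticSha V * (r : ℂ) * (Nat.card (AddCommGroup.primaryComponent W.sha p) : ℂ) *
          (Nat.card (AddCommGroup.primaryComponent W₀.sha p) : ℂ) =
        (Nat.card (AddCommGroup.primaryComponent V.sha p) : ℂ) * (shaAn W * shaAn W₀) := by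
  haveI : (W.baseChange K).IsElliptic := by
    rw [_root_.WeierstrassCurve.baseChange]; infer_instance
  obtain ⟨hfV, r, hr0, hrp, hQ⟩ := bsdQuotientP_baseChange_quadratic hM W K h2 W₀ hW₀ V hV p hfW hfW₀
  refine ⟨hfV, r, hr0, hrp, ?_⟩
  -- the leading coefficients multiply, transported to the model `V`
  obtain ⟨-, -, hΛK, -⟩ := quadraticLayer W K h2 W₀ hW₀ hL hL₀
  obtain ⟨CV, hCV⟩ := hV
  have hΛ : V.leadingLCoeff = W.leadingLCoeff * W₀.leadingLCoeff := by
    rw [← hCV, leadingLCoeff_smul, hΛK]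
  -- the `BSD_p` identity in the any-model currency for all three curves, cast to `ℂ`
  rw [← bsdQuotientP_rat_eq W, ← bsdQuotientP_rat_eq W₀] at hQ
  rw [← analyticSha_eq_shaAn, ← analyticSha_eq_shaAn]
  set NV := Nat.card (AddCommGroup.primaryComponent V.sha p)
  set NW := Nat.card (AddCommGroup.primaryComponent W.sha p)
  set NW₀ := Nat.card (AddCommGroup.primaryComponent W₀.sha p)
  set bV : ℝ := V.regulator * V.bsdPeriod * (V.modifiedTamagawaProduct : ℝ) /
    (V.torsionOrder : ℝ) ^ 2 with hbV
  set bW : ℝ := W.regulator * W.bsdPeriod * (W.modifiedTamagawaProduct : ℝ) /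
    (W.torsionOrder : ℝ) ^ 2 with hbW
  set bW₀ : ℝ := W₀.regulator * W₀.bsdPeriod * (W₀.modifiedTamagawaProduct : ℝ) /
    (W₀.torsionOrder : ℝ) ^ 2 with hbW₀
  have hQ' : (NV : ℝ) * bV = (r : ℝ) * ((NW : ℝ) * bW) * ((NW₀ : ℝ) * bW₀) := by
    rw [hbV, hbW, hbW₀]
    linear_combination hQ
  have hQc : (NV : ℂ) * (bV : ℂ) = (r : ℂ) * ((NW : ℂ) * (bW : ℂ)) * ((NW₀ : ℂ) * (bW₀ : ℂ)) := by
    have := congrArg (fun x : ℝ => (x : ℂ)) hQ'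
    push_cast at this
    exact_mod_cast this
  have aV : analyticSha V * (bV : ℂ) = V.leadingLCoeff := analyticSha_mul_B V
  have aW : analyticSha W * (bW : ℂ) = W.leadingLCoeff := analyticSha_mul_B W
  have aW₀ : analyticSha W₀ * (bW₀ : ℂ) = W₀.leadingLCoeff := analyticSha_mul_B W₀
  have hb : (bV : ℂ) * ((bW : ℂ) * (bW₀ : ℂ)) ≠ 0 :=
    mul_ne_zero (B_ne_zero V) (mul_ne_zero (B_ne_zero W) (B_ne_zero W₀))
  apply mul_right_cancel₀ hb
  calc analyticSha V * (r : ℂ) * (NW : ℂ) * (NW₀ : ℂ) * ((bV : ℂ) * ((bW : ℂ) * (bW₀ : ℂ)))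
      = (analyticSha V * (bV : ℂ)) * ((r : ℂ) * ((NW : ℂ) * (bW : ℂ)) * ((NW₀ : ℂ) * (bW₀ : ℂ))) := by
        ring
    _ = V.leadingLCoeff * ((NV : ℂ) * (bV : ℂ)) := by rw [aV, hQc]
    _ = (NV : ℂ) * ((analyticSha W * (bW : ℂ)) * (analyticSha W₀ * (bW₀ : ℂ))) * (bV : ℂ) := by
        rw [aW, aW₀, hΛ]; ring
    _ = (NV : ℂ) * (analyticSha W * analyticSha W₀) * ((bV : ℂ) * ((bW : ℂ) * (bW₀ : ℂ))) := by ring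

/-- The analytic order of `Ш` of an elliptic curve with an entire `L`-function is non-zero (the
leading coefficient is non-zero, `leadingLCoeff_ne_zero_holds`). [folklore] -/
private theorem analyticSha_ne_zero {F : Type} [Field F] [NumberField F] (V : WeierstrassCurve F)
    [V.IsElliptic] (hV : V.HasEntireLFunction) : analyticSha V ≠ 0 := by
  intro h0
  have h := analyticSha_mul_B V
  rw [h0, zero_mul] at h
  exact V.leadingLCoeff_ne_zero_holds hV h.symm

/-- **`δ_p(E/K) = δ_p(E) + δ_p(E^{(d_K)})`**, `δ_p(X) = ord_p #Ш_an(X) − ord_p #Ш(X)[p^∞]`, for the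
layer `K/ℚ`: in the situation of `analyticSha_baseChange_quadratic`, if Miller's `#Ш_an(E) = qW` and
`#Ш_an(E^{(d_K)}) = qW₀` are rational then `#Ш_an(E_K)` is a rational `qV`, all three are non-zero,
and `ord_p qV − ord_p #Ш(E_K)[p^∞] = (ord_p qW − ord_p #Ш(E)[p^∞]) + (ord_p qW₀ − ord_p #Ш(E^{(d_K)})[p^∞])`.
[cite: DokchitserDokchitserAnnals2010, §2.1 Thm. 2.3 (second clause) and its proof]
[cite: Miller2011LMS, §1 and Def. 1.1 (arXiv:1010.2431 p. 3)] -/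
theorem padicValRat_analyticSha_baseChange_quadratic
    (hM : Milne1972.bsdQuotientP_baseChange_relQuadratic_anyModel)
    (W : WeierstrassCurve ℚ) [W.IsElliptic] [W.IsGloballyMinimal]
    (K : Type) [Field K] [NumberField K] (h2 : Module.finrank ℚ K = 2)
    (W₀ : WeierstrassCurve ℚ) [W₀.IsElliptic] [W₀.IsGloballyMinimal]
    (hW₀ : ∃ C : VariableChange ℚ, C • W₀ = W.quadraticTwist (NumberField.discr K : ℚ))
    (V : WeierstrassCurve K) [V.IsElliptic] (hV : ∃ C : VariableChange K, C • W.baseChange K = V)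
    (p : ℕ) [Fact p.Prime]
    (hfW : Finite (AddCommGroup.primaryComponent W.sha p))
    (hfW₀ : Finite (AddCommGroup.primaryComponent W₀.sha p))
    (hL : W.HasEntireLFunction) (hL₀ : W₀.HasEntireLFunction)
    {qW qW₀ : ℚ} (hqW : shaAn W = (qW : ℂ)) (hqW₀ : shaAn W₀ = (qW₀ : ℂ)) :
    Finite (AddCommGroup.primaryComponent V.sha p) ∧
    ∃ qV : ℚ, analyticSha V = (qV : ℂ) ∧ qV ≠ 0 ∧ qW ≠ 0 ∧ qW₀ ≠ 0 ∧
      padicValRat p qV - padicValNat p (Nat.card (AddCommGroup.primaryComponent V.sha p)) =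
        (padicValRat p qW - padicValNat p (Nat.card (AddCommGroup.primaryComponent W.sha p))) +
        (padicValRat p qW₀ - padicValNat p (Nat.card (AddCommGroup.primaryComponent W₀.sha p))) := by
  obtain ⟨hfV, r, hr0, hrp, hprod⟩ :=
    analyticSha_baseChange_quadratic hM W K h2 W₀ hW₀ V hV p hfW hfW₀ hL hL₀
  refine ⟨hfV, ?_⟩
  have hqW0 : qW ≠ 0 := by
    intro h; apply analyticSha_ne_zero W hL; rw [analyticSha_eq_shaAn, hqW, h, Rat.cast_zero]
  have hqW₀0 : qW₀ ≠ 0 := by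
    intro h; apply analyticSha_ne_zero W₀ hL₀; rw [analyticSha_eq_shaAn, hqW₀, h, Rat.cast_zero]
  set NV := Nat.card (AddCommGroup.primaryComponent V.sha p) with hNV
  set NW := Nat.card (AddCommGroup.primaryComponent W.sha p) with hNW
  set NW₀ := Nat.card (AddCommGroup.primaryComponent W₀.sha p) with hNW₀
  haveI := hfV; haveI := hfW; haveI := hfW₀
  have hNV0 : NV ≠ 0 := Nat.card_pos.ne'
  have hNW0 : NW ≠ 0 := Nat.card_pos.ne'
  have hNW₀0 : NW₀ ≠ 0 := Nat.card_pos.ne'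
  set qV : ℚ := (NV : ℚ) * (qW * qW₀) / (r * NW * NW₀) with hqV_def
  have hden : (r : ℚ) * NW * NW₀ ≠ 0 := by
    refine mul_ne_zero (mul_ne_zero hr0 ?_) ?_ <;> exact_mod_cast ‹_ ≠ 0›
  have hqV : analyticSha V = (qV : ℂ) := by
    rw [hqW, hqW₀] at hprod
    have hdenC' : ((r : ℂ) * (NW : ℂ) * (NW₀ : ℂ)) ≠ 0 := by exact_mod_cast hden
    rw [hqV_def]
    push_cast
    rw [eq_div_iff hdenC']
    linear_combination hprod
  have hqV0 : qV ≠ 0 := by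
    rw [hqV_def]
    exact div_ne_zero (mul_ne_zero (by exact_mod_cast hNV0) (mul_ne_zero hqW0 hqW₀0)) hden
  refine ⟨qV, hqV, hqV0, hqW0, hqW₀0, ?_⟩
  have hvV : padicValRat p qV = padicValNat p NV + (padicValRat p qW + padicValRat p qW₀) -
      (padicValNat p NW + padicValNat p NW₀) := by
    rw [hqV_def, padicValRat.div (mul_ne_zero (by exact_mod_cast hNV0) (mul_ne_zero hqW0 hqW₀0)) hden,
      padicValRat.mul (by exact_mod_cast hNV0) (mul_ne_zero hqW0 hqW₀0), padicValRat.mul hqW0 hqW₀0,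
      padicValRat.mul (mul_ne_zero hr0 (by exact_mod_cast hNW0)) (by exact_mod_cast hNW₀0),
      padicValRat.mul hr0 (by exact_mod_cast hNW0), hrp, padicValRat.of_nat, padicValRat.of_nat,
      padicValRat.of_nat]
    ring
  rw [hvV]
  ring

/-! ### §3. Kriz–Li's two uses of "the invariance of BSD(2) under isogeny" (FMS §5.6):
(A) `BSD(E,p) ∧ BSD(E^{(d_K)},p) ⟹ BSD(E/K,p)` and (D) `BSD(E/K,p) ∧ BSD(E^{(d_K)},p) ⟹ BSD(E,p)`
(given the rank part and the finiteness of `Ш(E)[p^∞]`), in the currency `BSDpOver` -/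

/-- **(A) `BSD(E,p)` and `BSD(E^{(d_K)},p)` over `ℚ` give `BSD(E/K,p)`** — Kriz–Li, proof of Thm. 5.1
(2) (FMS §5.6 = arXiv §5.3, p0018 L59: "BSD(2) for `E/ℚ` and `E^{(d_K)}/ℚ` implies that BSD(2) is true
for `E/K`", by `E × E^{(d_K)} ∼ Res_{K/ℚ} E_K` and isogeny invariance [50]): for `W`, `W₀ ≅ W^{(d_K)}`
globally minimal with entire `L`-functions and Miller's `BSDp W p`, `BSDp W₀ p`, the base change
`W_K` satisfies the rank part `rank E(K) = r_an(E/K)` and `BSDpOver W_K p` (`Ш(E_K)[p^∞]` finite,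
`#Ш_an(E_K) ∈ ℚ`, `ord_p #Ш_an(E_K) = ord_p #Ш(E_K)[p^∞]`). PROVED from the tree's named fact
`Milne1972.bsdQuotientP_baseChange_relQuadratic_anyModel` (hypothesis `hM`) by the bookkeeping
`δ_p(E/K) = δ_p(E) + δ_p(E^{(d_K)})`.
[cite: KrizLi2019, §5.6 (FMS; proof of Thm. 5.1 (2)) = arXiv:1606.03172 §5.3 (p0018 L59)]
[cite: DokchitserDokchitserAnnals2010, §2.1 Thm. 2.3 (second clause) and its proof] -/
theorem bsdpOver_baseChange_of_bsdp
    (hM : Milne1972.bsdQuotientP_baseChange_relQuadratic_anyModel)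
    (W : WeierstrassCurve ℚ) [W.IsElliptic] [W.IsGloballyMinimal]
    (K : Type) [Field K] [NumberField K] (h2 : Module.finrank ℚ K = 2)
    (W₀ : WeierstrassCurve ℚ) [W₀.IsElliptic] [W₀.IsGloballyMinimal]
    (hW₀ : ∃ C : VariableChange ℚ, C • W₀ = W.quadraticTwist (NumberField.discr K : ℚ))
    (p : ℕ) [Fact p.Prime] (hL : W.HasEntireLFunction) (hL₀ : W₀.HasEntireLFunction)
    (hB : BSDp W p) (hB₀ : BSDp W₀ p) :
    (W.baseChange K).mordellWeilRank = (W.baseChange K).analyticRank ∧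
      BSDpOver (W.baseChange K) p := by
  haveI : (W.baseChange K).IsElliptic := by
    rw [_root_.WeierstrassCurve.baseChange]; infer_instance
  obtain ⟨hrW, hfW, qW, hqW, hvW⟩ := hB
  obtain ⟨hrW₀, hfW₀, qW₀, hqW₀, hvW₀⟩ := hB₀
  obtain ⟨-, hran, -, hrk⟩ := quadraticLayer W K h2 W₀ hW₀ hL hL₀
  refine ⟨by rw [hrk, hran, hrW, hrW₀], ?_⟩
  obtain ⟨hfV, qV, hqV, -, -, -, hδ⟩ := padicValRat_analyticSha_baseChange_quadratic hM W K h2 W₀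
    hW₀ (W.baseChange K) ⟨1, one_smul _ _⟩ p hfW hfW₀ hL hL₀ hqW hqW₀
  refine ⟨hfV, qV, hqV, ?_⟩
  rw [hvW, hvW₀] at hδ
  linarith

/-- **(D) `BSD(E/K,p)` and `BSD(E^{(d_K)},p)` give `BSD(E,p)`** — Kriz–Li, proof of Thm. 5.1 (2) (FMS
§5.6, last sentence = arXiv §5.3, p0018 L59: "again by the invariance of BSD(2) under isogeny, we know
BSD(2) is also true for the other rank one curve"): for `W`, `W₀ ≅ W^{(d_K)}` globally minimal over `ℚ`
with entire `L`-functions, `V` any `K`-model of `E_K` with `BSDpOver V p`, and `BSDp W₀ p`; if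
`Ш(E)[p^∞]` is finite and the rank part holds for `E`, then `BSDp W p` (`#Ш_an(E)` is rational by the
product formula, and `δ_p(E) = δ_p(E/K) − δ_p(E^{(d_K)}) = 0`). PROVED from `hM`.
[cite: KrizLi2019, §5.6 (FMS; proof of Thm. 5.1 (2), last sentence) = arXiv:1606.03172 §5.3 (p0018 L59)]
[cite: DokchitserDokchitserAnnals2010, §2.1 Thm. 2.3 (second clause) and its proof] -/
theorem bsdp_of_bsdpOver_baseChange
    (hM : Milne1972.bsdQuotientP_baseChange_relQuadratic_anyModel)
    (W : WeierstrassCurve ℚ) [W.IsElliptic] [W.IsGloballyMinimal]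
    (K : Type) [Field K] [NumberField K] (h2 : Module.finrank ℚ K = 2)
    (W₀ : WeierstrassCurve ℚ) [W₀.IsElliptic] [W₀.IsGloballyMinimal]
    (hW₀ : ∃ C : VariableChange ℚ, C • W₀ = W.quadraticTwist (NumberField.discr K : ℚ))
    (V : WeierstrassCurve K) [V.IsElliptic] (hV : ∃ C : VariableChange K, C • W.baseChange K = V)
    (p : ℕ) [Fact p.Prime] (hL : W.HasEntireLFunction) (hL₀ : W₀.HasEntireLFunction)
    (hfW : Finite (AddCommGroup.primaryComponent W.sha p))
    (hrank : W.mordellWeilRank = W.analyticRank)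
    (hK : BSDpOver V p) (hB₀ : BSDp W₀ p) : BSDp W p := by
  obtain ⟨-, hfW₀, qW₀, hqW₀, hvW₀⟩ := hB₀
  obtain ⟨-, qV', hqV', hvV'⟩ := hK
  obtain ⟨hfV, r, hr0, hrp, hprod⟩ :=
    analyticSha_baseChange_quadratic hM W K h2 W₀ hW₀ V hV p hfW hfW₀ hL hL₀
  haveI := hfV; haveI := hfW; haveI := hfW₀
  set NV := Nat.card (AddCommGroup.primaryComponent V.sha p) with hNV
  set NW := Nat.card (AddCommGroup.primaryComponent W.sha p) with hNW
  set NW₀ := Nat.card (AddCommGroup.primaryComponent W₀.sha p) with hNW₀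
  have hNV0 : NV ≠ 0 := Nat.card_pos.ne'
  have hqW₀0 : qW₀ ≠ 0 := by
    intro h; apply analyticSha_ne_zero W₀ hL₀; rw [analyticSha_eq_shaAn, hqW₀, h, Rat.cast_zero]
  -- `#Ш_an(E)` is rational, by the product formula
  set qW : ℚ := qV' * r * NW * NW₀ / (NV * qW₀) with hqW_def
  have hqW : shaAn W = (qW : ℂ) := by
    have hden : ((NV : ℂ) * (qW₀ : ℂ)) ≠ 0 :=
      mul_ne_zero (by exact_mod_cast hNV0) (by exact_mod_cast hqW₀0)
    rw [hqV', hqW₀] at hprod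
    rw [hqW_def]
    push_cast
    rw [eq_div_iff hden]
    linear_combination -hprod
  obtain ⟨-, qV, hqV, -, -, -, hδ⟩ := padicValRat_analyticSha_baseChange_quadratic hM W K h2 W₀ hW₀
    V hV p hfW hfW₀ hL hL₀ hqW hqW₀
  have hqq : qV = qV' := by exact_mod_cast hqV.symm.trans hqV'
  subst hqq
  rw [hvV', hvW₀] at hδ
  exact ⟨hrank, hfW, qW, hqW, by linarith⟩

/-! ### §4. The twist pair `E^{(d)}`, `E^{(d·d_K)}`: each is the `d_K`-twist of the other over `ℚ`,
and they become isomorphic over `K = ℚ(√d_K)` -/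

section TwistPair

variable (W : WeierstrassCurve ℚ) (K : Type) [Field K] [NumberField K] (d : ℤ)
  (W₁ W₂ : WeierstrassCurve ℚ)

/-- `E^{(d·d_K)} ≅ (E^{(d)})^{(d_K)}` over `ℚ`, on the chosen models: if `C₁ • W₁ = W^{(d)}` and
`C₂ • W₂ = W^{(d·d_K)}` then `C • W₂ = W₁^{(d_K)}` for some change of variables `C` over `ℚ`
(`quadraticTwist_quadraticTwist`, `quadraticTwist_smul`). [cite: SilvermanAEC2009, X.5 Cor. 5.4 with X.2 Prop. 2.4] -/
theorem exists_variableChange_twistPair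
    (h₁ : ∃ C : VariableChange ℚ, C • W₁ = W.quadraticTwist (d : ℚ))
    (h₂ : ∃ C : VariableChange ℚ, C • W₂ = W.quadraticTwist ((d * NumberField.discr K : ℤ) : ℚ)) :
    ∃ C : VariableChange ℚ, C • W₂ = W₁.quadraticTwist (NumberField.discr K : ℚ) := by
  haveI : NeZero (2 : ℚ) := ⟨two_ne_zero⟩
  obtain ⟨C₁, hC₁⟩ := h₁
  obtain ⟨C₂, hC₂⟩ := h₂
  have hW₁ : W₁ = C₁⁻¹ • W.quadraticTwist (d : ℚ) := by rw [← hC₁, inv_smul_smul]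
  rw [hW₁, quadraticTwist_smul, quadraticTwist_quadraticTwist]
  push_cast at hC₂
  exact ⟨⟨(C₁⁻¹).u, (NumberField.discr K : ℚ) * (C₁⁻¹).r, 0, 0⟩ * C₂, by rw [mul_smul, hC₂]⟩

/-- `E^{(d)} ≅ (E^{(d·d_K)})^{(d_K)}` over `ℚ` (`d · d_K · d_K = d · d_K²`, and twisting by a square
class is an isomorphism, `exists_variableChange_quadraticTwist_mul_sq`): if `C₁ • W₁ = W^{(d)}` and
`C₂ • W₂ = W^{(d·d_K)}` then `C • W₁ = W₂^{(d_K)}` for some `C`.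
[cite: SilvermanAEC2009, X.5 Cor. 5.4 with X.2 Prop. 2.4] -/
theorem exists_variableChange_twistPair'
    (h₁ : ∃ C : VariableChange ℚ, C • W₁ = W.quadraticTwist (d : ℚ))
    (h₂ : ∃ C : VariableChange ℚ, C • W₂ = W.quadraticTwist ((d * NumberField.discr K : ℤ) : ℚ)) :
    ∃ C : VariableChange ℚ, C • W₁ = W₂.quadraticTwist (NumberField.discr K : ℚ) := by
  haveI : NeZero (2 : ℚ) := ⟨two_ne_zero⟩
  have hD : (NumberField.discr K : ℚ) ≠ 0 := by exact_mod_cast NumberField.discr_ne_zero K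
  obtain ⟨C₁, hC₁⟩ := h₁
  obtain ⟨C₂, hC₂⟩ := h₂
  obtain ⟨C₃, hC₃⟩ :=
    W.exists_variableChange_quadraticTwist_mul_sq (d : ℚ) (NumberField.discr K : ℚ) hD
  push_cast at hC₂
  have hW₂ : W₂ = C₂⁻¹ • W.quadraticTwist ((d : ℚ) * (NumberField.discr K : ℚ)) := by
    rw [← hC₂, inv_smul_smul]
  have hsq : (d : ℚ) * (NumberField.discr K : ℚ) * (NumberField.discr K : ℚ) =
      (d : ℚ) * (NumberField.discr K : ℚ) ^ 2 := by ring
  rw [hW₂, quadraticTwist_smul, quadraticTwist_quadraticTwist, hsq, ← hC₃, ← hC₁, ← mul_smul,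
    ← mul_smul]
  exact ⟨_, rfl⟩

/-- **`E^{(d)} ≅ E^{(d·d_K)}` over `K = ℚ(√d_K)`**: with `d_K = c q²`, `c = θ²` (`θ ∈ K`), the twist by
`d_K = (θ q)²` is a `K`-isomorphism (`exists_variableChange_smul_eq_quadraticTwist_sq`), so the base
changes of the chosen models are related by a change of variables over `K`.
[cite: SilvermanAEC2009, X.5 Cor. 5.4 (iii)] -/
theorem exists_variableChange_baseChange_twistPair (h2 : Module.finrank ℚ K = 2)
    (h₁ : ∃ C : VariableChange ℚ, C • W₁ = W.quadraticTwist (d : ℚ))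
    (h₂ : ∃ C : VariableChange ℚ, C • W₂ = W.quadraticTwist ((d * NumberField.discr K : ℤ) : ℚ)) :
    ∃ C : VariableChange K, C • W₁.baseChange K = W₂.baseChange K := by
  haveI : NeZero (2 : K) := ⟨two_ne_zero⟩
  obtain ⟨C, hC⟩ := exists_variableChange_twistPair W K d W₁ W₂ h₁ h₂
  obtain ⟨θ, c, hθK, hθ⟩ :=
    Literature.NumberTheory.QuadraticFields.Quadratic.exists_sq_eq_algebraMap (F := ℚ) (K := K) h2
  obtain ⟨q, hq, hd⟩ := NumberField.exists_discr_eq_mul_sq h2 hθK hθ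
  have hθ0 : θ ≠ 0 := by
    rintro rfl
    exact hθK ⟨0, by rw [map_zero]⟩
  have hθq : θ * algebraMap ℚ K q ≠ 0 :=
    mul_ne_zero hθ0 (by rw [Ne, map_eq_zero]; exact hq)
  obtain ⟨C', hC'⟩ := (W₁.baseChange K).exists_variableChange_smul_eq_quadraticTwist_sq hθq
  have hDK : algebraMap ℚ K (NumberField.discr K : ℚ) = (θ * algebraMap ℚ K q) ^ 2 := by
    rw [hd, map_mul, map_pow, mul_pow, hθ]
  -- base change of `C • W₂ = W₁^{(d_K)}` to `K`
  have hK : C.map (algebraMap ℚ K) • W₂.baseChange K = C' • W₁.baseChange K := by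
    rw [hC', ← hDK, _root_.WeierstrassCurve.baseChange, map_variableChange, hC,
      map_quadraticTwist]
    rfl
  exact ⟨(C.map (algebraMap ℚ K))⁻¹ * C', by rw [mul_smul, ← hK, inv_smul_smul]⟩

end TwistPair

/-! ### §5. Theorem 5.1 (2) from Theorem 4.3, Theorem 5.1 (1), Lemma 5.12 and the two isogeny-invariance
steps — the printed proof of FMS §5.6 -/

/-- **Kriz–Li 2019, Thm. 5.1 (2) (FMS) = arXiv Thm. 1.12 (2), ASSEMBLED ALONG ITS PRINTED PROOF** (FMS
§5.6 = arXiv:1606.03172 §5.3, p0018 L59, verbatim: "Because the abelian surface `E × E^{(d_K)}/ℚ` is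
isogenous to the Weil restriction `Res_{K/ℚ} E` and the validity of the BSD conjecture for abelian
varieties is invariant under isogeny ([Milne2006]), we know that BSD(2) for `E/ℚ` and `E^{(d_K)}/ℚ`
implies that BSD(2) is true for `E/K`. Hence by Theorem 1.12 (1), BSD(2) is true for `E^{(d)}/K`. By
Lemma 5.3 [FMS 5.12], BSD(2) is true for the rank zero curve among `E^{(d)}/ℚ` and `E^{(d·d_K)}/ℚ` for
`d ∈ 𝒩` such that `χ_d(−N) = 1`. Then again by the invariance of BSD(2) under isogeny, we know BSD(2)
is also true for the other rank one curve among `E^{(d)}/ℚ` and `E^{(d·d_K)}/ℚ`.").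
The tree fact `thm112_bsdTwo_twist` FOLLOWS from:
* `h33 : thm33_rank_twist` — Kriz–Li Thm. 4.3 (FMS) = arXiv Thm. 3.3 (tree named fact, same file as
  the target): the rank part for `E^{(d)}`, `E^{(d·d_K)}` and `{r_an} = {0, 1}`;
* `hGZK : rank_eq_analyticRank_of_analyticRank_le_one` — Gross–Zagier–Kolyvagin (tree named fact
  bsd.S17; `Ш(E'/ℚ)` finite for `r_an(E') ≤ 1`, the finiteness the printed proof uses tacitly when it
  invokes isogeny invariance);
* `hMod : hasEntireLFunction_rat` — modularity / entire continuation (tree named fact; Artin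
  formalism `L(E/K,s) = L(E,s)L(E^{(d_K)},s)` is the tree's THEOREM `LSeries_baseChange_quadratic_holds`);
* `hM : Milne1972.bsdQuotientP_baseChange_relQuadratic_anyModel` — "[Milne2006]": Milne 1972 Thm. 1
  + isogeny invariance of `BSD_p`, as Dokchitser–Dokchitser 2010 Thm. 2.3 (`p`-part) (tree named fact);
  steps (A) and (D) are PROVED from it in §3;
* `h51` — **Kriz–Li Thm. 5.1 (1) (FMS) = arXiv Thm. 1.12 (1)**, TYPED INLINE (not a tree fact; the
  tree had no `BSD(2)`-over-`K` currency when the target was vendored, it now has `BSDpOver` of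
  `BSDQuotientOverNumberField.lean`): under the standing hypotheses of Thm. 5.1, "if BSD(2) is true
  for `E/K`, then BSD(2) is true for `E^{(d)}/K`, for any `d ∈ 𝒩`" — `BSD(2)` for a curve over `K` read
  as Miller's `BSD(·,2)` over `K`: rank part `rank E(K) = r_an(E/K)` and `BSDpOver (·_K) 2`;
* `h512` — **Kriz–Li Lemma 5.12 (FMS) = arXiv Lemma 5.3**, TYPED INLINE: under the same hypotheses,
  "if BSD(2) is true for `E/ℚ` and `E^{(d_K)}/ℚ`, then BSD(2) is true for all twists `E^{(d)}/ℚ` and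
  `E^{(d·d_K)}/ℚ` of rank zero, where `d ∈ 𝒩` with `χ_d(−N) = 1`" (rank zero read as `r_an = 0`;
  `= rank` by Thm. 4.3).
HONESTY: this is a reduction, not a discharge — `thm112_bsdTwo_twist_holds` needs `h51` (whose printed
proof is FMS §§5.2–5.4: the Gross–Zagier index formula (17)/(18), Lemma 5.4/5.7 via the `2`-adic
logarithm congruence of Thm. 4.3 (1) and the oddness of Manin constants under twisting (Stevens), Lemma
5.6 Tamagawa parities, Lemma 5.9 `Sel₂(E/K) ≅ Sel₂(E^{(d)}/K)`) and `h512` (FMS §5.5: Zhai 2016's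
`2`-adic valuations of `L(E^{(d)},1)/Ω`, Lemma 5.10, Cor. 5.11), neither of which the tree can prove
today; nothing here bears on the summit statement `BirchSwinnertonDyer`.
[cite: KrizLi2019, Thm. 5.1 and §5.6 (FMS; VoR p. 30 L43–50 for Thm. 5.1) = arXiv:1606.03172 Thm. 1.12 (p0004 L32–L42) and §5.3 (p0018 L59); Lemma 5.12 (FMS) = arXiv Lemma 5.3 (p0018 L47–L56)] -/
theorem thm112_bsdTwo_twist_of_overK_of_rankZero
    (h33 : thm33_rank_twist)
    (hGZK : rank_eq_analyticRank_of_analyticRank_le_one)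
    (hMod : hasEntireLFunction_rat)
    (hM : Milne1972.bsdQuotientP_baseChange_relQuadratic_anyModel)
    (h51 : ∀ (W : WeierstrassCurve ℚ) [W.IsElliptic] [W.IsGloballyMinimal] [NeZero (W.conductorNorm ℤ)],
      (∀ Q : W.toAffine.Point, 2 • Q = 0 → Q = 0) →
      ∀ (K : Type) [Field K] [NumberField K], IsImaginaryQuadratic K →
        SatisfiesHeegnerHypothesis (W.conductorNorm ℤ) K →
      ∀ (Dt : ModularParametrizationData W (W.conductorNorm ℤ))
        (H : HeegnerDatum (W.conductorNorm ℤ) (NumberField.discr K)) (ι : K →+* ℂ)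
        (P : (W.baseChange K).toAffine.Point),
        WeierstrassCurve.Affine.Point.map ι.toRatAlgHom P = heegnerPointComplex Dt H →
      ∀ (j : K →ₐ[ℚ] ℚ_[2]), AssumptionStar W Dt K P j →
      (haveI : Fact (2 : ℕ).Prime := ⟨Nat.prime_two⟩;
        Odd ((W.baseChange ℚ_[2]).localTamagawaNumber ℤ_[2]) ∧
          (¬ W.HasGoodReductionAtPrime 2 → ¬ W.HasMultiplicativeReductionAtPrime 2 → Odd Dt.c)) →
      ((W.baseChange K).mordellWeilRank = (W.baseChange K).analyticRank ∧
        BSDpOver (W.baseChange K) 2) →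
      ∀ (d : ℤ), InN W K d →
      ∀ (W₁ : WeierstrassCurve ℚ) [W₁.IsElliptic] [W₁.IsGloballyMinimal],
        (∃ C : VariableChange ℚ, C • W₁ = W.quadraticTwist (d : ℚ)) →
        (W₁.baseChange K).mordellWeilRank = (W₁.baseChange K).analyticRank ∧
          BSDpOver (W₁.baseChange K) 2)
    (h512 : ∀ (W : WeierstrassCurve ℚ) [W.IsElliptic] [W.IsGloballyMinimal] [NeZero (W.conductorNorm ℤ)],
      (∀ Q : W.toAffine.Point, 2 • Q = 0 → Q = 0) →
      ∀ (K : Type) [Field K] [NumberField K], IsImaginaryQuadratic K →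
        SatisfiesHeegnerHypothesis (W.conductorNorm ℤ) K →
      ∀ (Dt : ModularParametrizationData W (W.conductorNorm ℤ))
        (H : HeegnerDatum (W.conductorNorm ℤ) (NumberField.discr K)) (ι : K →+* ℂ)
        (P : (W.baseChange K).toAffine.Point),
        WeierstrassCurve.Affine.Point.map ι.toRatAlgHom P = heegnerPointComplex Dt H →
      ∀ (j : K →ₐ[ℚ] ℚ_[2]), AssumptionStar W Dt K P j →
      (haveI : Fact (2 : ℕ).Prime := ⟨Nat.prime_two⟩;
        Odd ((W.baseChange ℚ_[2]).localTamagawaNumber ℤ_[2]) ∧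
          (¬ W.HasGoodReductionAtPrime 2 → ¬ W.HasMultiplicativeReductionAtPrime 2 → Odd Dt.c)) →
      ∀ (W₀ : WeierstrassCurve ℚ) [W₀.IsElliptic] [W₀.IsGloballyMinimal],
        (∃ C : VariableChange ℚ, C • W₀ = W.quadraticTwist (NumberField.discr K : ℚ)) →
        BSDp W 2 → BSDp W₀ 2 →
      ∀ (d : ℤ), InN W K d → Int.sign d * jacobiSym (W.conductorNorm ℤ) d.natAbs = 1 →
      ∀ (W₁ W₂ : WeierstrassCurve ℚ) [W₁.IsElliptic] [W₁.IsGloballyMinimal] [W₂.IsElliptic]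
        [W₂.IsGloballyMinimal],
        (∃ C : VariableChange ℚ, C • W₁ = W.quadraticTwist (d : ℚ)) →
        (∃ C : VariableChange ℚ, C • W₂ = W.quadraticTwist ((d * NumberField.discr K : ℤ) : ℚ)) →
          (W₁.analyticRank = 0 → BSDp W₁ 2) ∧ (W₂.analyticRank = 0 → BSDp W₂ 2)) :
    thm112_bsdTwo_twist := by
  intro W _ _ _ h2t K _ _ hK hHe Dt H ι P hP j hSt hodd W₀ _ _ hW₀ hB hB₀ d hd hχ W₁ W₂ _ _ _ _ hW₁ hW₂
  haveI : Fact (2 : ℕ).Prime := ⟨Nat.prime_two⟩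
  have h2 : Module.finrank ℚ K = 2 := hK.1
  -- Theorem 4.3: the rank parts and the dichotomy `{r_an(E^{(d)}), r_an(E^{(d d_K)})} = {0, 1}`
  obtain ⟨hr₁, hr₂, hdich, -⟩ := h33 W h2t K hK hHe Dt H ι P hP j hSt d hd W₁ W₂ hW₁ hW₂
  -- Lemma 5.12: BSD(2) for the rank-zero twist
  obtain ⟨h0₁, h0₂⟩ := h512 W h2t K hK hHe Dt H ι P hP j hSt hodd W₀ hW₀ hB hB₀ d hd hχ W₁ W₂ hW₁ hW₂
  -- (A) BSD(2) for `E/K`, then Theorem 5.1 (1): BSD(2) for `E^{(d)}/K`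
  have hL : W.HasEntireLFunction := hMod W
  have hL₀ : W₀.HasEntireLFunction := hMod W₀
  have hL₁ : W₁.HasEntireLFunction := hMod W₁
  have hL₂ : W₂.HasEntireLFunction := hMod W₂
  have hA := bsdpOver_baseChange_of_bsdp hM W K h2 W₀ hW₀ 2 hL hL₀ hB hB₀
  obtain ⟨-, hBK⟩ := h51 W h2t K hK hHe Dt H ι P hP j hSt hodd hA d hd W₁ hW₁
  -- (D) the rank-one twist, by isogeny invariance through `E^{(d)}_K ≅ E^{(d d_K)}_K`
  rcases hdich with ⟨h1, h0⟩ | ⟨h0, h1⟩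
  · have hB₂ : BSDp W₂ 2 := h0₂ h0
    have hf₁ : Finite (AddCommGroup.primaryComponent W₁.sha 2) := by
      obtain ⟨-, hfin⟩ := hGZK W₁ (by rw [h1])
      haveI := hfin
      infer_instance
    have htw := exists_variableChange_twistPair W K d W₁ W₂ hW₁ hW₂
    exact ⟨bsdp_of_bsdpOver_baseChange hM W₁ K h2 W₂ htw (W₁.baseChange K) ⟨1, one_smul _ _⟩ 2
      hL₁ hL₂ hf₁ hr₁ hBK hB₂, hB₂⟩
  · have hB₁ : BSDp W₁ 2 := h0₁ h0
    have hf₂ : Finite (AddCommGroup.primaryComponent W₂.sha 2) := by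
      obtain ⟨-, hfin⟩ := hGZK W₂ (by rw [h1])
      haveI := hfin
      infer_instance
    have htw := exists_variableChange_twistPair' W K d W₁ W₂ hW₁ hW₂
    obtain ⟨CK, hCK⟩ := exists_variableChange_baseChange_twistPair W K d W₁ W₂ h2 hW₁ hW₂
    have hV : ∃ C : VariableChange K, C • W₂.baseChange K = W₁.baseChange K :=
      ⟨CK⁻¹, by rw [← hCK, inv_smul_smul]⟩
    exact ⟨hB₁, bsdp_of_bsdpOver_baseChange hM W₂ K h2 W₁ htw (W₁.baseChange K) hV 2 hL₂ hL₁ hf₂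
      hr₂ hBK hB₁⟩

/-! ### §6. The last step of Lemma 5.12 (FMS) = arXiv Lemma 5.3: `BSD(E', p)` for a curve of analytic
rank zero from `p`-adic units (stated for any prime `p`; Kriz–Li use it at `p = 2`) -/

/-- `A[p] = 0 ⟹ A[p^∞] = 0`: if multiplication by `p` is injective on an abelian group then so is
multiplication by every `p^k`, so the `p`-primary component is trivial. [folklore] -/
private theorem eq_zero_of_mem_primaryComponent {A : Type*} [AddCommGroup A] {p : ℕ}
    (h : ∀ x : A, p • x = 0 → x = 0) {x : A} (hx : x ∈ AddCommGroup.primaryComponent A p) :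
    x = 0 := by
  obtain ⟨k, hk⟩ := (AddCommGroup.mem_primaryComponent).mp hx
  induction k generalizing x with
  | zero => simpa using hk
  | succ k ih =>
    refine h x (ih (x := p • x) ((AddCommGroup.mem_primaryComponent).mpr ⟨k, ?_⟩) ?_) <;>
      rw [smul_smul, ← pow_succ, hk]

/-- **Kriz–Li 2019, proof of Lemma 5.12 (FMS) = arXiv Lemma 5.3, its last step** (arXiv p0018 L50–L56,
verbatim, for the rank-zero curve `E' ∈ {E^{(d)}, E^{(d·d_K)}}` at `p = 2`: "`L(E'/ℚ,1)/Ω(E'/ℚ)` is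
also a `2`-adic unit (notice that the Néron period `Ω(E/ℚ)` is twice of the real period when
`Δ(E) > 0`). Since all the local Tamagawa numbers `c_ℓ(E')` are odd (Lemma 4.3 [FMS 5.6]) and
`Ш(E'/ℚ)[2] = 0` (Lemma 5.1 [FMS 5.10] …), we know that BSD(2) is true for `E'/ℚ`."), made precise
in Miller's currency (`BSDp`, `shaAn`; LMS J. Comput. Math. 14 (2011) Def. 1.1): for a globally
minimal `W/ℚ` of analytic rank `0` satisfying the rank part, if `L(E,1) = q_L · Ω(E)` with
`ord_p q_L = 0` (`Ω = W.realPeriodRat`, the Néron period), `p ∤ ∏_ℓ c_ℓ`, `p ∤ #E(ℚ)_tors` and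
`Ш(E/ℚ)[p] = 0`, then `BSD(E,p)`: indeed `Reg = 1`, so `#Ш_an = q_L · #E(ℚ)_tors² / ∏ c_ℓ` has
`ord_p = 0`, and `Ш[p] = 0` forces `Ш[p^∞] = 0`. (The hypothesis `p ∤ #E(ℚ)_tors` is implicit in print:
`E'(ℚ)[2] = 0` as `E'[2] ≅ E[2]` has no rational points.)
[cite: KrizLi2019, Lemma 5.12 (FMS), proof = arXiv:1606.03172 Lemma 5.3, proof (p0018 L50–L56)]
[cite: Miller2011LMS, Def. 1.1 and §1 (arXiv:1010.2431 p. 3)] -/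
theorem bsdp_of_analyticRank_eq_zero_of_padicUnits (W : WeierstrassCurve ℚ) [W.IsElliptic]
    [W.IsGloballyMinimal] (p : ℕ) [Fact p.Prime]
    (hr : W.analyticRank = 0) (hrank : W.mordellWeilRank = W.analyticRank)
    {qL : ℚ} (hL : W.leadingLCoeff = (qL : ℂ) * (W.realPeriodRat : ℂ)) (hLp : padicValRat p qL = 0)
    (hc : ¬ p ∣ W.tamagawaProduct) (htor : ¬ p ∣ W.torsionOrder)
    (hsha : ∀ x : W.sha, p • x = 0 → x = 0) : BSDp W p := by
  -- `Ш[p^∞] = 0`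
  have hzero : ∀ x : AddCommGroup.primaryComponent W.sha p, x = 0 := fun x =>
    Subtype.ext (eq_zero_of_mem_primaryComponent hsha x.2)
  haveI : Subsingleton (AddCommGroup.primaryComponent W.sha p) :=
    ⟨fun a b => by rw [hzero a, hzero b]⟩
  haveI : Nonempty (AddCommGroup.primaryComponent W.sha p) := ⟨0⟩
  have hcard : Nat.card (AddCommGroup.primaryComponent W.sha p) = 1 := Nat.card_unique
  refine ⟨hrank, Finite.of_subsingleton, qL * (W.torsionOrder : ℚ) ^ 2 / (W.tamagawaProduct : ℚ),
    ?_, ?_⟩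
  · -- `#Ш_an = L(E,1) #tors² / (Ω ∏c Reg) = q_L #tors² / ∏c`
    have hReg : W.regulator = 1 := W.regulator_eq_one_of_rank_zero (hrank.trans hr)
    have hΩ : (W.realPeriodRat : ℂ) ≠ 0 := by exact_mod_cast (W.realPeriodRat_pos_holds).ne'
    have hc0' : W.tamagawaProduct ≠ 0 := fun h => hc (by rw [h]; exact dvd_zero p)
    have hc0 : (W.tamagawaProduct : ℂ) ≠ 0 := by exact_mod_cast hc0'
    rw [shaAn_def, hL, hReg]
    push_cast
    field_simp
  · -- valuations: `ord_p q_L = ord_p #tors = ord_p ∏c = 0 = ord_p #Ш[p^∞]`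
    rw [hcard]
    have ht0' : W.torsionOrder ≠ 0 := fun h => htor (by rw [h]; exact dvd_zero p)
    have hc0' : W.tamagawaProduct ≠ 0 := fun h => hc (by rw [h]; exact dvd_zero p)
    have ht0 : (W.torsionOrder : ℚ) ≠ 0 := by exact_mod_cast ht0'
    have hc0 : (W.tamagawaProduct : ℚ) ≠ 0 := by exact_mod_cast hc0'
    by_cases hq : qL = 0
    · simp [hq]
    rw [padicValRat.div (mul_ne_zero hq (pow_ne_zero 2 ht0)) hc0,
      padicValRat.mul hq (pow_ne_zero 2 ht0), padicValRat.pow (W.torsionOrder : ℚ),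
      padicValRat.of_nat, padicValRat.of_nat, hLp, padicValNat.eq_zero_of_not_dvd htor,
      padicValNat.eq_zero_of_not_dvd hc]
    simp

/-- **`E(K)[p] = 0 ⟹ p ∤ #E(K)_tors`** (Cauchy's theorem in the finite group `E(K)_tors`): the
hypothesis "`p ∤ #E'(ℚ)_tors`" of `bsdp_of_analyticRank_eq_zero_of_padicUnits` in the form in which
Kriz–Li state it ("`E` has no rational `2`-torsion", arXiv p0017 L5; for the twists, `E^{(d)}[2] ≅ E[2]`,
p0016 L60). [cite: KrizLi2019, proof of Lemma 5.7 (FMS) = arXiv Lemma 4.4 (p0017 L5) ("no rational 2-torsion")] -/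
theorem not_dvd_torsionOrder_of_torsionBy_trivial {F : Type*} [Field F] [NumberField F]
    (V : WeierstrassCurve F) [V.IsElliptic] (p : ℕ) [Fact p.Prime]
    (h : ∀ Q : V.toAffine.Point, p • Q = 0 → Q = 0) : ¬ p ∣ V.torsionOrder := by
  haveI := V.finite_torsion_point
  intro hdvd
  obtain ⟨x, hx⟩ := exists_prime_addOrderOf_dvd_card' (G := AddCommGroup.torsion V.toAffine.Point)
    p hdvd
  have hx0 : (x : V.toAffine.Point) = 0 := h x (by
    rw [← AddSubgroup.coe_nsmul, ← hx, addOrderOf_nsmul_eq_zero, AddSubgroup.coe_zero])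
  have : addOrderOf x = 1 := by
    rw [AddMonoid.addOrderOf_eq_one_iff]
    exact Subtype.ext hx0
  rw [this] at hx
  exact (Fact.out : p.Prime).one_lt.ne hx

end Literature.NumberTheory.EllipticCurves.KrizLi2019

end
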